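import Mathlib
import HarnessLib
import Summits.Langlands.Langlands.Theses.SkinnerWilesDefectOne
import Summits.Langlands.Langlands.Theorems.SkinnerWilesDefectOneReducibleOrdinaryProModularDefs
import Summits.Langlands.Langlands.Theorems.SkinnerWilesDefectOneReducibleOrdinaryProModularFineSelmerDefs
import Summits.Langlands.Langlands.Theorems.SkinnerWilesDefectOneReducibleOrdinaryProModularSeedPatchingPrimeRealised
import Summits.Langlands.Langlands.Theorems.SkinnerWilesDefectOneProModularOfEisensteinSeedPointsOverOE
import Summits.Langlands.Langlands.Theorems.SkinnerWilesDefectOneProModularOfEisensteinSeedAdicCompact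
import Literature.NumberTheory.GaloisRepresentations.NearlyOrdinaryDeformationRing
import Literature.NumberTheory.GaloisRepresentations.PadicIntermediateFieldIntegers
import Literature.NumberTheory.GaloisRepresentations.PadicAlgClFiniteSubextensionDvr

/-!
# Stub (P2) `stub_seedPatchingPrime`: reduction to "the seed's `r` is a type-`𝒟` point of the model"

Route `SkinnerWilesDefectOne`, crux `ReducibleOrdinaryProModular` (stmt-Langlands-12919), line
`fine-selmer-codimension-two`, stub (P2) `stub_seedPatchingPrime` ("the seed's pro-modular point `r` gives a
pro-modular PATCHING prime of `R_𝒟 = M.𝓡.R`").  The landed realised sub-case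
(`stub_seedPatchingPrime_auxRealised`, `…SeedPatchingPrimeRealised.lean`) settles (P2) as soon as `r` is
realised by an `𝒪_L`-valued ring homomorphism `ψ : R_𝒟 → 𝒪_L` over which `𝒪_L` is integral.  This file
closes the remaining DEFORMATION-THEORETIC bookkeeping between that sub-case and Skinner–Wiles' formulation
"`r` is a deformation of type `𝒟`" ([SW, §4.4, proof of Prop. 4.2]: "(P2) holds for the datum `𝒟₀`" as soon
as the pro-modular `r` is of type `𝒟₀`), and isolates exactly what the registered stub still owes:

* `algebraMap_padicInt_mem_range`, `isIntegral_of_ringHom_intermediateFieldIntegers` — AUTOMATIC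
  INTEGRALITY: for a complete Noetherian local ring `R` with finite residue field and ANY ring homomorphism
  `ψ : R → 𝒪_L` (`L/ℚ_p` finite inside `ℚ̄_p`), `𝒪_L` is integral over `ψ(R)`.  Indeed `ψ` is continuous
  (landed `continuous_coe_comp_intermediateFieldIntegers`) and `R` is compact (landed
  `compactSpace_adic_of_isNoetherianRing`), so `ψ(R) ⊆ ℚ̄_p` is closed; it contains `ℤ`, hence its closure
  `ℤ_p`; and `𝒪_L ⊆ {‖x‖ ≤ 1}` is integral over `ℤ_p` (tree `PadicAlgCl.norm_le_one_iff_isIntegral`), the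
  minimal polynomial lifting coefficientwise to `R[X]` (Mathlib `Polynomial.lifts_and_degree_eq_and_monic`).
  So the hypothesis `ψ.IsIntegral` of the realised sub-case is free.
* `isIrreducible_of_seedData`, `isPadicallyAutomorphic_of_seedData`, `ordinary_of_seedData` — the three
  clauses of the seed (`SeedData`, the body of `EisensteinProModularSeed`) that the realised sub-case consumes
  (irreducibility, `p`-adic automorphy of level `𝒰`, ordinarity of parallel weight `k ≥ 2` with the
  orientation inequality dropped).
* `exists_realises_of_isDeformation` — UNIVERSALITY: if `r` is, up to `GL₂(ℚ̄_p)`-conjugation, the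
  push-forward along a ring homomorphism `j : A → 𝒪_L` of a deformation `r_A : Γ_F → GL₂(A)` OF TYPE `𝒟`
  (`𝒟.IsDeformation π_A r_A`: `r_A mod 𝔪_A = ρ̄_𝒟` ON THE NOSE, unramified outside `𝒟.S`, nearly ordinary at
  `v ∣ p` with the residual special lines of `𝒟`) to a test ring `(A, π_A)` of the interface
  `NearlyOrdinaryDeformationRing` (complete Noetherian local `𝒪`-algebra with augmentation onto `k`), then
  `R_𝒟.universal` gives `φ_A : R_𝒟 →ₐ[𝒪] A` and `ψ = j ∘ φ_A : R_𝒟 → 𝒪_L` realises `r` (the strict equivalence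
  is absorbed into the conjugating matrix) — "`r` is a type-`𝒟` point of the model".
* `exists_isPatchingPrime_of_realises`, `exists_isPatchingPrime_of_seedData_of_isDeformation` and the
  registered sub-goal `stub_seedPatchingPrime_auxOfTypeD` — **(P2) for every model `M` of which the seed's `r`
  is a type-`𝒟` point**: the registered signature of `stub_seedPatchingPrime` with that single extra
  hypothesis (spelled out as an `∃` over test rings) inserted before the conclusion, proved from the above and
  the landed `stub_seedPatchingPrime_auxRealised`.

What (P2) as registered still owes is therefore precisely Skinner–Wiles' TRANSPORT "(P2) for one datum
`𝒟₀` ⟹ (P2) for every `𝒟`" ([SW, Prop. 4.2], proved in §4.4 through the reducible locus using (P1) on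
companion data), or — in the unique-admissible-class regime — Berger–Klosin residual uniqueness; neither is
a hypothesis of the registered stub, and the seed (`EisensteinProModularSeed`) promises the residual
DIAGONAL of `ρ₀` only, not the extension class of `M.𝒟` ("possibly for another extension class — SW
transport the class afterwards", route file).

References: C. M. Skinner, A. J. Wiles, *Residually reducible representations and modular forms*, Publ.
Math. IHÉS 89 (1999), §2.1, §4.1 (p. 62), §4.4 (proof of Prop. 4.2) [SkinnerWiles1999]; B. Mazur, *An
introduction to the deformation theory of Galois representations* (1997), §8, §20 Prop. 2
[Mazur1997Deformation]; J. Neukirch, *Algebraic Number Theory* (1999), II (4.8) [NeukirchANT1999].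
-/

set_option linter.dupNamespace false -- project-wide option (lakefile weak.linter.dupNamespace); `Summit.Langlands.Langlands` is the mandated namespace
set_option autoImplicit false

namespace Summit.Langlands.Langlands.Cruxes.ReducibleOrdinaryProModular.FineSelmerCodimensionTwo

open scoped NumberField MatrixGroups
open Filter NumberField IsDedekindDomain Field Matrix IsLocalRing
open Literature.NumberTheory.Automorphic Literature.NumberTheory.Automorphic.BigHeckeGLn
open Literature.NumberTheory.GaloisRepresentations
open Summit.Langlands.Langlands.Theses.SkinnerWilesDefectOne
open Summit.Langlands.Langlands.Cruxes.ReducibleOrdinaryProModular.SteinbergHyperplane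

noncomputable section

/-! ## 1. Automatic integrality of `𝒪_L` over the image of a compact coefficient ring -/

section Integrality

variable {p : ℕ} [Fact p.Prime] (L : IntermediateField ℚ_[p] (PadicAlgCl p)) [FiniteDimensional ℚ_[p] L]

/-- **`ℤ_p ⊆ ψ(R)`.**  For a complete Noetherian local ring `R` with finite residue field and any ring
homomorphism `ψ : R → 𝒪_L`, every element of `ℤ_p ⊆ ℚ̄_p` lies in the image of `R → 𝒪_L ⊆ ℚ̄_p`: the image is
compact (continuity is automatic, `continuous_coe_comp_intermediateFieldIntegers`; `R` is compact,
`compactSpace_adic_of_isNoetherianRing`), hence closed, and contains `ℤ`, which is dense in `ℤ_p`.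
[cite: Mazur1997Deformation, §2] -/
theorem algebraMap_padicInt_mem_range {R : Type*} [CommRing R] [IsLocalRing R] [IsNoetherianRing R]
    [IsAdicComplete (maximalIdeal R) R] [Finite (ResidueField R)]
    (ψ : R →+* intermediateFieldIntegers p L) (a : ℤ_[p]) :
    algebraMap ℤ_[p] (PadicAlgCl p) a ∈
      ((((algebraMap L (PadicAlgCl p)).comp (intermediateFieldIntegers p L).subtype).comp ψ).range :
        Set (PadicAlgCl p)) := by
  set φ : R →+* PadicAlgCl p :=
    (((algebraMap L (PadicAlgCl p)).comp (intermediateFieldIntegers p L).subtype).comp ψ) with hφ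
  -- the image of `R` is closed
  have hclosed : IsClosed (φ.range : Set (PadicAlgCl p)) := by
    letI : TopologicalSpace R := (maximalIdeal R).adicTopology
    haveI : CompactSpace R := Summit.Langlands.Langlands.Theorems.compactSpace_adic_of_isNoetherianRing R
    rw [RingHom.coe_range]
    exact (isCompact_range (continuous_coe_comp_intermediateFieldIntegers L ψ)).isClosed
  -- `ℤ_p → ℚ̄_p` is continuous and `ℤ` is dense in `ℤ_p`
  have hcont : Continuous (algebraMap ℤ_[p] (PadicAlgCl p)) := by
    have he : (algebraMap ℤ_[p] (PadicAlgCl p) : ℤ_[p] → PadicAlgCl p) =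
        (algebraMap ℚ_[p] (PadicAlgCl p)) ∘ ((↑) : ℤ_[p] → ℚ_[p]) := by
      funext a
      exact IsScalarTower.algebraMap_apply ℤ_[p] ℚ_[p] (PadicAlgCl p) a
    rw [he]
    exact (continuous_algebraMap ℚ_[p] (PadicAlgCl p)).comp continuous_subtype_val
  have hmem : algebraMap ℤ_[p] (PadicAlgCl p) a ∈ closure (φ.range : Set (PadicAlgCl p)) := by
    refine map_mem_closure hcont (PadicInt.denseRange_intCast (p := p) a) fun x hx => ?_
    obtain ⟨n, rfl⟩ := hx
    exact ⟨(n : R), by rw [map_intCast, map_intCast]⟩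
  rwa [hclosed.closure_eq] at hmem

/-- **Automatic integrality.**  For a complete Noetherian local ring `R` with finite residue field and ANY
ring homomorphism `ψ : R → 𝒪_L` (`L/ℚ_p` finite inside `ℚ̄_p`), `𝒪_L` is integral over `ψ(R)`: an element
of `𝒪_L` has norm `≤ 1`, so is integral over `ℤ_p` (`PadicAlgCl.norm_le_one_iff_isIntegral`, Neukirch II
(4.8)), and its monic integral equation lifts coefficientwise to `R[X]` because `ℤ_p ⊆ ψ(R)`
(`algebraMap_padicInt_mem_range`). [cite: NeukirchANT1999, II (4.8)] -/
theorem isIntegral_of_ringHom_intermediateFieldIntegers {R : Type*} [CommRing R] [IsLocalRing R]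
    [IsNoetherianRing R] [IsAdicComplete (maximalIdeal R) R] [Finite (ResidueField R)]
    (ψ : R →+* intermediateFieldIntegers p L) : ψ.IsIntegral := by
  intro x
  set emb : intermediateFieldIntegers p L →+* PadicAlgCl p :=
    (algebraMap L (PadicAlgCl p)).comp (intermediateFieldIntegers p L).subtype with hemb
  -- `x` is integral over `ℤ_p`
  have hx1 : ‖emb x‖ ≤ 1 := by
    change ‖((x : L) : PadicAlgCl p)‖ ≤ 1
    rw [← intermediateFieldIntegers.norm_coe]
    exact intermediateFieldIntegers.norm_le_one L x
  obtain ⟨g, hgm, hgx⟩ := (PadicAlgCl.norm_le_one_iff_isIntegral (emb x)).mp hx1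
  -- lift `g` along `emb ∘ ψ`
  have hlifts : g.map (algebraMap ℤ_[p] (PadicAlgCl p)) ∈ Polynomial.lifts (emb.comp ψ) := by
    rw [Polynomial.lifts_iff_coeff_lifts]
    intro n
    rw [Polynomial.coeff_map]
    exact algebraMap_padicInt_mem_range L ψ (g.coeff n)
  obtain ⟨q, hq, -, hqm⟩ := Polynomial.lifts_and_degree_eq_and_monic hlifts (hgm.map _)
  refine ⟨q, hqm, coe_comp_subtype_injective L ?_⟩
  change emb (Polynomial.eval₂ ψ x q) = emb 0
  rw [Polynomial.hom_eval₂, map_zero, ← Polynomial.eval_map, hq, Polynomial.eval_map]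
  exact hgx

end Integrality

/-! ## 2. The clauses of the seed consumed by the realised sub-case -/

section Seed

variable {F : Type} [Field F] [NumberField F] {p : ℕ} [Fact p.Prime] {O : ValuationSubring (PadicAlgCl p)}
  {ρ₀ : absoluteGaloisGroup F →* GL (Fin 2) O} {𝒰 : TameLevel 2 F p} {r : FramedGaloisRep F (PadicAlgCl p) 2}
  {r₀ : absoluteGaloisGroup F →* GL (Fin 2) O} {q : HeightOneSpectrum (𝓞 F)}

/-- The seed's `r` is irreducible (first clause of `SeedData`). [folklore] -/
theorem isIrreducible_of_seedData (h : SeedData p ρ₀ 𝒰 r r₀ q) : r.toGaloisRep.IsIrreducible := h.1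

/-- The seed's `r` is `p`-adically automorphic of level `𝒰` (second clause of `SeedData`). [folklore] -/
theorem isPadicallyAutomorphic_of_seedData (h : SeedData p ρ₀ 𝒰 r r₀ q) : 𝒰.IsPadicallyAutomorphic r := h.2.1

/-- The seed's `r` is ordinary of ONE parallel weight `k ≥ 2` with exponent `m ≥ 1` at every `v ∣ p` (the
seed's oriented-ordinary clause with the orientation inequality `‖Q₀₀‖ ≤ ‖Q₁₀‖` dropped — the shape the
realised sub-case `stub_seedPatchingPrime_auxRealised` consumes). [folklore] -/
theorem ordinary_of_seedData (h : SeedData p ρ₀ 𝒰 r r₀ q) :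
    ∃ k : ℕ, 2 ≤ k ∧ ∃ m : ℕ, 0 < m ∧ ∀ v : HeightOneSpectrum (𝓞 F), (p : 𝓞 F) ∈ v.asIdeal →
      ∃ Q : Matrix.GeneralLinearGroup (Fin 2) (PadicAlgCl p),
        ∀ σ, (Q⁻¹ * r.toLocal v σ * Q).val 1 0 = 0 ∧ (σ ∈ absInertia (v.adicCompletion F) →
          (Q⁻¹ * r.toLocal v σ * Q).val 1 1 ^ m = 1 ∧ (Q⁻¹ * r.toLocal v σ * Q).val 0 0 ^ m =
            algebraMap (Padic p) (PadicAlgCl p) (((GaloisRep.cyclotomicCharacter (v.adicCompletion F) p σ).val :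
              PadicInt p) : Padic p) ^ ((k - 1) * m)) := by
  obtain ⟨k, hk, m, hm, hloc⟩ := h.2.2.2.2.1
  refine ⟨k, hk, m, hm, fun v hv => ?_⟩
  obtain ⟨Q, -, hQ⟩ := hloc v hv
  exact ⟨Q, hQ⟩

end Seed

/-! ## 3. Universality: a type-`𝒟` point is realised; realised points give patching primes -/

section Universality

variable {F : Type} [Field F] [NumberField F] {p : ℕ} [Fact p.Prime]
variable {𝒪 : Type} [CommRing 𝒪] {k : Type} [Field k] [Algebra 𝒪 k] {𝒟 : NearlyOrdinaryDatum F p 𝒪 k}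
variable (𝓡 : NearlyOrdinaryDeformationRing.{0} 𝒟)

/-- **Universality: a type-`𝒟` point is realised by an `𝒪_L`-valued point of `R_𝒟`.**  Let `(A, π_A)` be a
test ring of the interface (a complete Noetherian local `𝒪`-algebra with augmentation onto `k`), `r_A` a
deformation OF TYPE `𝒟` to it, and `j : A → 𝒪_L` (`L/ℚ_p` finite inside `ℚ̄_p`) a ring homomorphism pushing
`r_A` to a `GL₂(ℚ̄_p)`-conjugate of `r`.  The universal property of `R_𝒟` gives `φ_A : R_𝒟 →ₐ[𝒪] A` with
`φ_A ∘ ρ_𝒟` strictly equivalent to `r_A` (`r_A = Q (φ_A ∘ ρ_𝒟) Q⁻¹`, `Q ≡ 1 mod 𝔪_A`), so `ψ = j ∘ φ_A`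
realises `r` with conjugating matrix `P · j(Q)` ("the deformation corresponds to a map `R_𝒟 → A`").
[cite: SkinnerWiles1999, §2.1] -/
theorem exists_realises_of_isDeformation (A : Type) [CommRing A] [IsLocalRing A] [IsNoetherianRing A]
    [Algebra 𝒪 A] [IsAdicComplete (maximalIdeal A) A] (πA : A →ₐ[𝒪] k) (hπA : Function.Surjective πA)
    (rA : absoluteGaloisGroup F →* GL (Fin 2) A) (hdef : 𝒟.IsDeformation πA rA)
    (L : IntermediateField ℚ_[p] (PadicAlgCl p)) (j : A →+* intermediateFieldIntegers p L)
    (r : FramedGaloisRep F (PadicAlgCl p) 2) (P : GL (Fin 2) (PadicAlgCl p))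
    (hP : ∀ g, Matrix.GeneralLinearGroup.map
      (((algebraMap L (PadicAlgCl p)).comp (intermediateFieldIntegers p L).subtype).comp j) (rA g) = P⁻¹ * r g * P) :
    ∃ (ψ : 𝓡.R →+* intermediateFieldIntegers p L) (P' : GL (Fin 2) (PadicAlgCl p)),
      ∀ g, Matrix.GeneralLinearGroup.map
        (((algebraMap L (PadicAlgCl p)).comp (intermediateFieldIntegers p L).subtype).comp ψ) (𝓡.ρ g) =
          P'⁻¹ * r g * P' := by
  obtain ⟨φ, ⟨Q, -, hQ⟩, -⟩ := 𝓡.universal A πA hπA rA hdef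
  set emb : intermediateFieldIntegers p L →+* PadicAlgCl p :=
    (algebraMap L (PadicAlgCl p)).comp (intermediateFieldIntegers p L).subtype with hemb
  refine ⟨j.comp (φ : 𝓡.R →+* A), P * Matrix.GeneralLinearGroup.map (emb.comp j) Q, fun g => ?_⟩
  have h1 : Matrix.GeneralLinearGroup.map (φ : 𝓡.R →+* A) (𝓡.ρ g) = Q⁻¹ * rA g * Q := by
    have := hQ g
    rw [MonoidHom.comp_apply] at this
    rw [this]; group
  change Matrix.GeneralLinearGroup.map ((emb.comp j).comp (φ : 𝓡.R →+* A)) (𝓡.ρ g) = _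
  rw [Matrix.GeneralLinearGroup.map_comp, MonoidHom.comp_apply, h1, map_mul, map_mul, map_inv, hP g]
  group

end Universality

section Model

variable {F : Type} [Field F] [NumberField F] {p : ℕ} [Fact p.Prime]

/-- **Realised points give pro-modular patching primes** (the realised sub-case with its integrality
hypothesis discharged): if an `𝒪_L`-valued ring homomorphism `ψ` on `M.𝓡.R` realises an irreducible,
`p`-adically automorphic (level `𝒰`), ordinary (parallel weight `k ≥ 2`) `r` up to conjugation, then `R_𝒟` has
a patching prime which is pro-modular — namely `ker (R_𝒟 → 𝒪_L ⊆ ℚ̄_p)` (landed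
`stub_seedPatchingPrime_auxRealised`, fed with `isIntegral_of_ringHom_intermediateFieldIntegers`; the residue
field of `M.𝓡.R` is the finite `M.k`). [cite: SkinnerWiles1999, §4.1 p. 62 and §4.4] -/
theorem exists_isPatchingPrime_of_realises (M : ModelData F p) (L : IntermediateField ℚ_[p] (PadicAlgCl p))
    [FiniteDimensional ℚ_[p] L] (ψ : M.𝓡.R →+* intermediateFieldIntegers p L)
    (r : FramedGaloisRep F (PadicAlgCl p) 2) (P : GL (Fin 2) (PadicAlgCl p))
    (hψ : ∀ g, Matrix.GeneralLinearGroup.map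
      (((algebraMap L (PadicAlgCl p)).comp (intermediateFieldIntegers p L).subtype).comp ψ) (M.𝓡.ρ g) =
        P⁻¹ * r g * P)
    (hirr : r.toGaloisRep.IsIrreducible) (𝒰 : TameLevel 2 F p) (hr : 𝒰.IsPadicallyAutomorphic r)
    (hord : ∃ k : ℕ, 2 ≤ k ∧ ∃ m : ℕ, 0 < m ∧ ∀ v : HeightOneSpectrum (𝓞 F), (p : 𝓞 F) ∈ v.asIdeal →
      ∃ Q : Matrix.GeneralLinearGroup (Fin 2) (PadicAlgCl p),
        ∀ σ, (Q⁻¹ * r.toLocal v σ * Q).val 1 0 = 0 ∧ (σ ∈ absInertia (v.adicCompletion F) →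
          (Q⁻¹ * r.toLocal v σ * Q).val 1 1 ^ m = 1 ∧ (Q⁻¹ * r.toLocal v σ * Q).val 0 0 ^ m =
            algebraMap (Padic p) (PadicAlgCl p) (((GaloisRep.cyclotomicCharacter (v.adicCompletion F) p σ).val :
              PadicInt p) : Padic p) ^ ((k - 1) * m))) :
    ∃ 𝔭 : PrimeSpectrum M.𝓡.R, IsPatchingPrime M.𝓡 𝔭 ∧ IsProModularPrime M.𝓡 𝔭 := by
  haveI : Finite (ResidueField M.𝓡.R) := finite_residueField M.𝓡
  exact stub_seedPatchingPrime_auxRealised F p M L ψ (isIntegral_of_ringHom_intermediateFieldIntegers L ψ)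
    r P hirr hψ 𝒰 hr hord

/-- **(P2) for the seed, at every model of which the seed's `r` is a type-`𝒟` point.**  From `SeedData`
(irreducible, `p`-adically automorphic of level `𝒰`, ordinary) and a deformation of type `M.𝒟` over a test
ring `(A, π_A)` pushed by `j : A → 𝒪_L` to a conjugate of `r`: `R_𝒟 = M.𝓡.R` has a pro-modular patching
prime (universality `exists_realises_of_isDeformation`, then `exists_isPatchingPrime_of_realises`).
[cite: SkinnerWiles1999, §4.4] -/
theorem exists_isPatchingPrime_of_seedData_of_isDeformation {O : ValuationSubring (PadicAlgCl p)}
    {ρ₀ : absoluteGaloisGroup F →* GL (Fin 2) O} {𝒰 : TameLevel 2 F p} {r : FramedGaloisRep F (PadicAlgCl p) 2}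
    {r₀ : absoluteGaloisGroup F →* GL (Fin 2) O} {q : HeightOneSpectrum (𝓞 F)} (hseed : SeedData p ρ₀ 𝒰 r r₀ q)
    (M : ModelData F p) (A : Type) [CommRing A] [IsLocalRing A] [IsNoetherianRing A] [Algebra M.𝒪 A]
    [IsAdicComplete (maximalIdeal A) A] (πA : A →ₐ[M.𝒪] M.k) (hπA : Function.Surjective πA)
    (rA : absoluteGaloisGroup F →* GL (Fin 2) A) (hdef : M.𝒟.IsDeformation πA rA)
    (L : IntermediateField ℚ_[p] (PadicAlgCl p)) [FiniteDimensional ℚ_[p] L]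
    (j : A →+* intermediateFieldIntegers p L) (P : GL (Fin 2) (PadicAlgCl p))
    (hP : ∀ g, Matrix.GeneralLinearGroup.map
      (((algebraMap L (PadicAlgCl p)).comp (intermediateFieldIntegers p L).subtype).comp j) (rA g) = P⁻¹ * r g * P) :
    ∃ 𝔭 : PrimeSpectrum M.𝓡.R, IsPatchingPrime M.𝓡 𝔭 ∧ IsProModularPrime M.𝓡 𝔭 := by
  obtain ⟨ψ, P', hψ⟩ := exists_realises_of_isDeformation M.𝓡 A πA hπA rA hdef L j r P hP
  exact exists_isPatchingPrime_of_realises M L ψ r P' hψ (isIrreducible_of_seedData hseed) 𝒰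
    (isPadicallyAutomorphic_of_seedData hseed) (ordinary_of_seedData hseed)

end Model

/-! ## 4. The registered sub-goal: stub (P2) with the type-`𝒟` hypothesis spelled out -/

/-- **Registered sub-goal `stub_seedPatchingPrime_auxOfTypeD` of stub (P2) `stub_seedPatchingPrime`
(line `fine-selmer-codimension-two`, crux stmt-Langlands-12919).**  The registered signature of (P2),
verbatim, with ONE extra hypothesis inserted before the conclusion — "the seed's `r` is a type-`𝒟` point of
the model `M`": there are a test ring `A` of the interface `NearlyOrdinaryDeformationRing` (a complete
Noetherian local `M.𝒪`-algebra with an augmentation `π_A` ONTO `M.k`), a deformation `r_A : Γ_F → GL₂(A)` OF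
TYPE `M.𝒟` (`M.𝒟.IsDeformation π_A r_A`: `r_A mod 𝔪_A = ρ̄_𝒟` on the nose, unramified outside `M.𝒟.S`,
nearly ordinary at `v ∣ p` with the residual special lines of `M.𝒟`), and a ring homomorphism `A → 𝒪_L`
(`L/ℚ_p` finite inside `ℚ̄_p`) pushing `r_A` to a `GL₂(ℚ̄_p)`-conjugate of `r`.  Then `R_𝒟 = M.𝓡.R` has a
patching prime which is pro-modular.  Proof: universality of `M.𝓡`, automatic integrality, and the landed
realised sub-case.  What is left of (P2) as registered is exactly Skinner–Wiles' transport of the residual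
type between admissible data [SW, Prop. 4.2] (or residual uniqueness in the unique-class regime), which
produces this hypothesis. [cite: SkinnerWiles1999, §4.4] -/
theorem stub_seedPatchingPrime_auxOfTypeD :
    ∀ (F : Type) [Field F] [NumberField F], IsTotallyComplex F → Module.finrank ℚ F = 2 →
      ∀ (p : ℕ) [Fact p.Prime], p ≠ 2 →
      ∀ (O : ValuationSubring (PadicAlgCl p)),
        O = (Valued.v : Valuation (PadicAlgCl p) NNReal).valuationSubring →
      ∀ (ρ : FramedGaloisRep F (PadicAlgCl p) 2) (ρ₀ : absoluteGaloisGroup F →* GL (Fin 2) O),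
        ρ.toGaloisRep.IsIrreducible → (∀ᶠ v in cofinite, ρ.IsUnramifiedAt v) →
        ρ.HasUpperTriangularIntegralModel ρ₀ → OrdLoc p O ρ ρ₀ →
      ∀ (𝒰 : TameLevel 2 F p) (r : FramedGaloisRep F (PadicAlgCl p) 2)
        (r₀ : absoluteGaloisGroup F →* GL (Fin 2) O) (q : HeightOneSpectrum (𝓞 F)), SeedData p ρ₀ 𝒰 r r₀ q →
      ∀ M : ModelData F p, M.Models ρ ρ₀ (baseLevel ρ ∪ {q}) → M.IsLocalPoint → SmallReducibleLocus M.𝓡 →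
        (∃ (A : Type) (_ : CommRing A) (_ : IsLocalRing A) (_ : IsNoetherianRing A) (_ : Algebra M.𝒪 A)
            (_ : IsAdicComplete (IsLocalRing.maximalIdeal A) A) (πA : A →ₐ[M.𝒪] M.k)
            (_ : Function.Surjective πA) (rA : absoluteGaloisGroup F →* GL (Fin 2) A)
            (_ : M.𝒟.IsDeformation πA rA) (L : IntermediateField ℚ_[p] (PadicAlgCl p))
            (_ : FiniteDimensional ℚ_[p] L) (j : A →+* intermediateFieldIntegers p L)
            (P : GL (Fin 2) (PadicAlgCl p)),
            ∀ g, Matrix.GeneralLinearGroup.map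
              (((algebraMap L (PadicAlgCl p)).comp (intermediateFieldIntegers p L).subtype).comp j) (rA g) =
                P⁻¹ * r g * P) →
        ∃ 𝔭 : PrimeSpectrum M.𝓡.R, IsPatchingPrime M.𝓡 𝔭 ∧ IsProModularPrime M.𝓡 𝔭 := by
  intro F _ _ _ _ p _ _ O _ ρ ρ₀ _ _ _ _ 𝒰 r r₀ q hseed M _ _ _ hT
  obtain ⟨A, _, _, _, _, _, πA, hπA, rA, hdef, L, hL, j, P, hP⟩ := hT
  haveI := hL
  exact exists_isPatchingPrime_of_seedData_of_isDeformation hseed M A πA hπA rA hdef L j P hP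

end

end Summit.Langlands.Langlands.Cruxes.ReducibleOrdinaryProModular.FineSelmerCodimensionTwo
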